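import Summits.BirchSwinnertonDyer.BirchSwinnertonDyer.Theses.EisensteinCountDoorRankTwo
import HarnessLib

/-!
# BirchSwinnertonDyer / EisensteinCountDoorRankTwo — the assembly item (stmt-BirchSwinnertonDyer-23556)

Route `route-BirchSwinnertonDyer-EisensteinCountDoorRankTwo` (D-0145 ideator line bsd-idea-4 #3;
director-bsd W-59: T-tier DOOR target «T-r2E», the sibling of `CountingDoorF2AtThree`'s T-r2).
The assembly item is the chain
`EisensteinCountTwoSupply → PublishedInputs → EisensteinCountDoorKernel → InfinitelyManyRankTwoPadicBSD`,
which is literally the route's deciding theorem `closes` (sorry-free in the route file): on each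
member of the supply the kernel at `k = 2` gives `corank Sel_p ≤ ord_T L_p ≤ 2`, two independent
points and the tree identity `selmerCorank = mordellWeilRank + shaCorank` give
`2 ≤ rank ≤ corank Sel_p`, hence `rank = corank Sel_p = ord_T L_p = 2` and `shaCorank = 0`;
`Set.Infinite.mono` transports infinitude of discriminants.

This is a DOOR route: nothing here proves a class theorem at rank `≥ 2`, and BSD is NOT proved by it.
PARTITION: none — r_an ≥ 2, summit axis S0; TWIN (D-0056): n/a. B1 honesty: term-level glue only.
-/

set_option linter.dupNamespace false

namespace Summit.BirchSwinnertonDyer.BirchSwinnertonDyer.Theorems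

open Summit.BirchSwinnertonDyer.BirchSwinnertonDyer.Theses.EisensteinCountDoorRankTwo

/-- **The assembly item of route `EisensteinCountDoorRankTwo` holds** (stmt-BirchSwinnertonDyer-23556
`Assembly`): the Eisenstein-count supply, the published inputs and the door kernel imply the
route-local leaf `InfinitelyManyRankTwoPadicBSD` — this is the route's deciding theorem `closes`
after unfolding (Kato's inequality `corank Sel_p ≤ ord_T L_p` squeezed against two rational points
and the residual count `p^(2 + Σδ)`).
[cite: GreenbergVatsal2000, §3 Thm. (3.11), p. 43] [cite: Kato2004, Thm. 18.4, p. 281] -/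
theorem eisensteinCountDoorRankTwo_assembly_proof :
    Summit.BirchSwinnertonDyer.BirchSwinnertonDyer.Theses.EisensteinCountDoorRankTwo.Assembly := by
  unfold Summit.BirchSwinnertonDyer.BirchSwinnertonDyer.Theses.EisensteinCountDoorRankTwo.Assembly
  exact fun hS hIn hK ↦ closes hS hIn hK

end Summit.BirchSwinnertonDyer.BirchSwinnertonDyer.Theorems
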